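import Summits.BirchSwinnertonDyer.Rank1Residual.Partition.MainConjecturesCMSupersingular
import Summits.BirchSwinnertonDyer.Rank1Residual.Supersingular.KobayashiMainConjecture

/-!
# BC5 witness of weakness (sibling-model rung) for the Kobayashi lower-half cruxes of route
`SignedLowerHalves` (cruxes 2/3: `∃ ε, KobayashiLowerDivisibility W p ε`; crux 4: `∃ ε,
KobayashiMainConjecture W p ε`).

MODEL: the CM good-supersingular locus (`W.HasCM`, `p ≠ 2`, `GoodSS W p`). There the cruxes'
EXACT predicate is a theorem of the published record — Pollack–Rubin 2004 Thm. 7.3 (named fact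
`PollackRubin2004.mainTheorem_signedCharIdeal_eq_of_cm`, used BY NAME as a hypothesis) gives the
full signed main conjecture for EVERY sign, hence its Eisenstein (lower) half — in ALL analytic
ranks, whereas `BSD(E,p)` (the summit-side statement S) is known on that locus only for
`analyticRank ≤ 1` (rank 0: Rubin 1991; rank 1: Kobayashi 2013) and is OPEN for rank ≥ 2.
So the rung decides C's analogue in a regime where S's analogue is not decided: the cruxes are
rank-blind Λ-adic divisibilities, strictly weaker in kind than S. The leaf `SignedSupersingular`
excludes CM by hypothesis (`¬ W.HasCM`), so the rung is the sibling setting, not a case of S.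
-/

namespace Summit.BirchSwinnertonDyer.BirchSwinnertonDyer.Theses.SignedLowerHalves.BC5

open WeierstrassCurve Literature.NumberTheory.EllipticCurves
open Literature.NumberTheory.EllipticCurves.Rank1Residual
open Literature.NumberTheory.EllipticCurves.PollackRubin2004
open Summit.BirchSwinnertonDyer.Rank1Residual Summit.BirchSwinnertonDyer.Rank1Residual.Supersingular

/-- **Rung (CM model), main-conjecture form = the predicate of crux 4
`KobayashiMainConjectureSmallImage`**: on the CM good-supersingular locus, for every sign.
[cite: PollackRubin2004, Theorem (p. 448) = Thm. 7.3] -/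
theorem KobayashiMainConjecture_rungCM (hPR : mainTheorem_signedCharIdeal_eq_of_cm)
    (W : WeierstrassCurve ℚ) [W.IsElliptic] [W.IsGloballyMinimal] (p : ℕ) [Fact p.Prime]
    (hcm : W.HasCM) (hp : p ≠ 2) (hss : GoodSS W p) :
    ∃ ε : ℤˣ, KobayashiMainConjecture W p ε :=
  ⟨1, kobayashiMainConjecture_of_pollackRubin_of_goodSS W p hPR hcm hp hss 1⟩

/-- **Rung (CM model), lower-half form = the predicate of cruxes 2/3
`KobayashiLowerHalfSemistable` / `KobayashiLowerHalfLargeImage`**: on the CM good-supersingular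
locus, in every analytic rank, from Pollack–Rubin 2004 by name.
[cite: PollackRubin2004, Theorem (p. 448) = Thm. 7.3] [cite: Kobayashi2003, Thm. 1.3 / Thm. 4.1] -/
theorem KobayashiLowerHalf_rungCM (hPR : mainTheorem_signedCharIdeal_eq_of_cm)
    (W : WeierstrassCurve ℚ) [W.IsElliptic] [W.IsGloballyMinimal] (p : ℕ) [Fact p.Prime]
    (hcm : W.HasCM) (hp : p ≠ 2) (hss : GoodSS W p) :
    ∃ ε : ℤˣ, KobayashiLowerDivisibility W p ε :=
  ⟨1, kobayashiLowerDivisibility_of_mainConjecture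
    (kobayashiMainConjecture_of_pollackRubin_of_goodSS W p hPR hcm hp hss 1)⟩

/-- Both signs at once (the main conjecture for every `ε`), for the record. -/
theorem KobayashiLowerHalf_rungCM_allSigns (hPR : mainTheorem_signedCharIdeal_eq_of_cm)
    (W : WeierstrassCurve ℚ) [W.IsElliptic] [W.IsGloballyMinimal] (p : ℕ) [Fact p.Prime]
    (hcm : W.HasCM) (hp : p ≠ 2) (hss : GoodSS W p) (ε : ℤˣ) :
    KobayashiLowerDivisibility W p ε :=
  kobayashiLowerDivisibility_of_mainConjecture
    (kobayashiMainConjecture_of_pollackRubin_of_goodSS W p hPR hcm hp hss ε)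

end Summit.BirchSwinnertonDyer.BirchSwinnertonDyer.Theses.SignedLowerHalves.BC5
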